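/-
Copyright (c) 2026 the pub-hodgecm-mathlib formalisation cell (harness21).  Prover seat hodgecm-mathlib-LH4-p09 (g10) (VALVE hand; K1b desk K2Liu-p14 (g5) DESK WORD #9 (2):
writer of the ONE-FRAME ASSEMBLY), Track B «K2-LIT» ∕ hLiu418 socket #41 KIND 1, package (K1b-♮), letter (P-dec) ∕ (dec-3), file (dec-3c): THE CORNER ROW OF A BLOCK
DECOMPOSITION OF THE TRANSLATE — transport through a block-diagonal Levi element, the row identity, and the faces against the height.  THEOREMS ONLY.
-/
import Summits.HodgeConjecture.HodgeConjecture.Theorems.K2LiuKindOneLineDecayLowerPowerFace   -- ★ p863856∕p863979 (dec-3b-ii): §1 scalar bookkeeping (+ ★ G7, ★ G7-B)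
import HarnessLib

/-!
# Crux `HLiu418`, socket #41, KIND 1 — (P-dec) ∕ (dec-3), file (dec-3c) `K2LiuKindOneLineCornerBlockFaces`: THE CORNER ROW OF A BLOCK DECOMPOSITION OF THE TRANSLATE

Cell `hodgecm-mathlib`, crux item hLiu418 = `stmt-HodgeConjecture-24832` (helper lane `--supports … --as helper`, count-neutral), route of record `HCCMUnconditional`;
squad K2 ∕ K2Liu; K1b desk K2Liu-p14 (g5) DESK WORD #9 (2) (2026-09-05T01:08:56Z): the ONE-FRAME ASSEMBLY `K2LiuKindOneLineDecayOneFrame` (producer of the (P-dec) head's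
letter `hdecF₀`, ★ LH4-p14 (g8) `K2LiuKindOneLineDecay.wdec_of_oneFrame`) — THIS FILE is its (dec-3) glue in the ★ G7 frame currency.
THEOREMS ONLY (no `def`, no `instance`, no notation, no named-fact hypothesis, no `sorry`).

THE POINT [MoeglinWaldspurger1995, II.1.5, II.1.7], [BorelJacquet1979, §1.2, §4.1], [Shimura1997, §18.4, §A3].  The KIND-1 line term reads the translate `x = Λ(ĝ)·h` of the
big group `H = U(n,n)` (`n = 2`) at an archimedean place through a block decomposition `T·x̃·T⁻¹ = [Y, B; 0, D]·κ` (★ G7 `K2LiuIwasawaHeightLatticeSumBound`, block type `p`,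
`|p| = n`); the LINE sits on a distinguished row `i₀` (the see-saw corner, ★ (e∞) `K2LiuKindOneLineCornerArchReading`), and the fine letter's archimedean factor is a function of
the CORNER ROW `Y_{i₀•}` — its squared length `ρ_σ = Σ_k ‖Y σ i₀ k‖²` is the square `|a₀₀|²` of the line's Levi coordinate, `‖det Y σ‖ ∕ ρ_σ^{1∕2}` the off-corner one.  Three facts:
* §1 TRANSPORT (pure block algebra): a block-DIAGONAL Levi element in the frame, `T·λ̃·T⁻¹ = fromBlocks G 0 0 G′`, carries a block decomposition of `h̃` to one of `λ̃·h̃` with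
  corner block `G·A` and the SAME movers — `fromBlocks_diag_mul_decomp`, **`blockDecomp_mul_of_diag`**; so the translate `Λ(ĝ)·h` is decomposed from `h` ALONE (the EXPORT
  RULING of the (K1b-W) organ: the Gaussian must see `‖h‖`, not `‖Λ(ĝ)·h‖`).
* §2 THE CORNER ROW: the row identity **`corner_row_sq_eq`** `Σ_k ‖(G·A) i₀ k‖² = Σ_k ‖((G i₀ •) ᵥ* A) k‖²` (so ★ (ρ4-𝔸) `exists_exp_neg_sum_le_exp_neg_height`'s letter
  `Σ_k ‖(φ(ĝ_{i₀•}) ᵥ* A)_k‖² ≤ a²` holds with EQUALITY at `a² := ρ`), and the two-sided bound from `Y·Y′ = 1`, entries `≤ R`: `1 ≤ (|p| R²)·ρ`, `ρ ≤ |p| R²`, `0 < ρ` —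
  `one_le_card_mul_sq_mul_rowSq`, `rowSq_le_card_mul_sq`, `rowSq_pos`; hence `ρ^t ≤ (|p| R²)^{|t|}` for EVERY real `t` (★ (dec-3b-ii) §1 `rpow_le_rpow_abs`) — `rowSq_rpow_le`;
  the determinant twin `‖det Y‖^t ≤ (|p|!·R^{|p|})^{|t|}` — `norm_det_rpow_le`.
* §3 THE FACES AGAINST THE HEIGHT OF THE POINT (★ G7-B `block_entry_bounds`: `R = c_B·‖x‖`, `c_B = (2|p|)³M³`), for EVERY block decomposition, exponents of EITHER sign with
  `|t| ≤ t₀` (the `hdecb` locality): **`prod_rowSq_rpow_le_height`** `∏_σ ρ_σ^t ≤ C·‖x‖^{A′}`, **`prod_norm_det_rpow_le_height`** `∏_σ ‖det Y σ‖^t ≤ C·‖x‖^{A′}`, and the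
  polynomial face **`prod_one_add_mul_rowSq_pow_le_height`** `∏_σ (1 + m_σ ρ_σ)^k ≤ C^k·‖x‖^{2#S k}·(1 + Σ_σ m_σ)^{#S k}` (`m_σ ≥ 0`, read `|μ|_σ`).
The one-frame assembly reads them at the data of record (`F := L⁺`, `E := L`, `c :=` complex conjugation, `N := 2 + 2`, `J := hermD`, `p := Fin 2`, `i₀ := 1`), with
`x := Λ₀(γ₀[w])·h` and ★ (dec-3b-i) `K2LiuKindOneLineTranslateHeight` for `‖x‖ ≤ C·(D(1+τ))^k·‖h‖` (polynomial faces only — the Gaussian goes through ★ (ρ4-𝔸) on `h`).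
HONEST LABEL.  Count-neutral helper, by value in the frame letters; closes no socket: `HC_CM` is proved only modulo the 7 printed citations (2 remaining named inputs:
hLiu418 = `stmt-HodgeConjecture-24832`, h413 = `stmt-HodgeConjecture-24833`) until rung 0 closes.
-/

set_option autoImplicit false
set_option linter.dupNamespace false -- the mandated namespace repeats `HodgeConjecture.HodgeConjecture`

noncomputable section

namespace Summit.HodgeConjecture.HodgeConjecture.Cruxes.HLiu418.K2LiuKindOneLineCornerBlockFaces

open scoped BigOperators Matrix
open Summit.HodgeConjecture.HodgeConjecture.Cruxes.HLiu418.K2LiuKindOneLineDecayLowerPowerFace (rpow_le_rpow_abs rpow_le_rpow_of_abs_le one_le_of_le_of_inv_le)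
open Summit.HodgeConjecture.HodgeConjecture.Cruxes.HLiu418.K2LiuArchBlockHeightBound (norm_det_le_of_entry_le norm_archAt_archPart_apply_le)
open Summit.HodgeConjecture.HodgeConjecture.Cruxes.HLiu418.K2LiuIwasawaHeightLatticeSumBound (block_entry_bounds exists_adelicHeightGL_floor)

/-! ## §1 Transport of a block decomposition through a block-diagonal Levi element -/

section Transport

variable {p : Type*} [Fintype p]

/-- block algebra: `fromBlocks G 0 0 G′ · ([A, b; 0, d] · κ) = [G A, G b; 0, G′ d] · κ`. [folklore] -/
theorem fromBlocks_diag_mul_decomp (G G' A b d : Matrix p p ℂ) (κ : Matrix (p ⊕ p) (p ⊕ p) ℂ) :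
    Matrix.fromBlocks G 0 0 G' * (Matrix.fromBlocks A b 0 d * κ) = Matrix.fromBlocks (G * A) (G * b) 0 (G' * d) * κ := by
  rw [← Matrix.mul_assoc, Matrix.fromBlocks_multiply]
  simp

/-- **TRANSPORT**: in a frame `(T, T⁻¹)` (`T⁻¹ T = 1`), if the Levi element is block-diagonal, `T·λ̃·T⁻¹ = fromBlocks G 0 0 G′`, and the point has the block decomposition
`T·h̃·T⁻¹ = [A, b; 0, d]·κ`, then the translate has the block decomposition `T·(λ̃ h̃)·T⁻¹ = [G A, G b; 0, G′ d]·κ` with the SAME movers.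
[cite: MoeglinWaldspurger1995, II.1.5] [cite: BorelJacquet1979, §4.1] -/
theorem blockDecomp_mul_of_diag [DecidableEq p] {T Tinv lam hm : Matrix (p ⊕ p) (p ⊕ p) ℂ} (hT' : Tinv * T = 1) {G G' A b d : Matrix p p ℂ} {κ : Matrix (p ⊕ p) (p ⊕ p) ℂ}
    (hlam : T * lam * Tinv = Matrix.fromBlocks G 0 0 G') (hdec : T * hm * Tinv = Matrix.fromBlocks A b 0 d * κ) :
    T * (lam * hm) * Tinv = Matrix.fromBlocks (G * A) (G * b) 0 (G' * d) * κ := by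
  have h1 : (T * lam * Tinv) * (T * hm * Tinv) = T * (lam * hm) * Tinv := by
    calc (T * lam * Tinv) * (T * hm * Tinv) = T * lam * (Tinv * T) * hm * Tinv := by simp only [Matrix.mul_assoc]
      _ = T * (lam * hm) * Tinv := by rw [hT', Matrix.mul_one]; simp only [Matrix.mul_assoc]
  rw [← h1, hlam, hdec, fromBlocks_diag_mul_decomp]

/-- the same transport for a `reindex`ed product (the frames of record conjugate `reindex r.symm r.symm (λ̃ · h̃) = reindex … λ̃ · reindex … h̃`). [folklore] -/
theorem reindex_mul_eq {N : ℕ} (r : p ⊕ p ≃ Fin N) (lam hm : Matrix (Fin N) (Fin N) ℂ) :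
    Matrix.reindex r.symm r.symm (lam * hm) = Matrix.reindex r.symm r.symm lam * Matrix.reindex r.symm r.symm hm := by
  rw [Matrix.reindex_apply, Matrix.reindex_apply, Matrix.reindex_apply, Equiv.symm_symm, Matrix.submatrix_mul_equiv]

end Transport

/-! ## §2 The corner row: the row identity and the two-sided bound -/

section CornerRow

variable {p : Type*} [Fintype p]

/-- **THE ROW IDENTITY**: `(G·A) i₀ k = ((G i₀ •) ᵥ* A) k`, hence `Σ_k ‖(G·A) i₀ k‖² = Σ_k ‖((G i₀ •) ᵥ* A) k‖²` — the corner row of the transported block IS the row of `G`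
moved by `A` (★ (ρ4-𝔸)'s letter `Σ_k ‖(φ(ĝ_{i₀•}) ᵥ* A)_k‖² ≤ a²` with equality). [folklore] -/
theorem corner_row_sq_eq (G A : Matrix p p ℂ) (i₀ : p) : ∑ k, ‖(G * A) i₀ k‖ ^ 2 = ∑ k, ‖((fun l => G i₀ l) ᵥ* A) k‖ ^ 2 :=
  Finset.sum_congr rfl fun k _ => by rw [Matrix.mul_apply]; rfl

/-- Cauchy–Schwarz over a `Fintype`: `(Σ_k a_k)² ≤ |p| · Σ_k a_k²`. [folklore] -/
theorem sq_sum_le_card_mul_sum_sq (a : p → ℝ) : (∑ k, a k) ^ 2 ≤ Fintype.card p * ∑ k, a k ^ 2 := by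
  have h := Finset.sum_mul_sq_le_sq_mul_sq Finset.univ a (fun _ => (1 : ℝ))
  simp only [mul_one, one_pow, Finset.sum_const, Finset.card_univ, nsmul_eq_mul] at h
  linarith

/-- **FLOOR OF THE CORNER ROW**: `Y·Y′ = 1` with the entries of `Y′` bounded by `R` ⇒ `1 ≤ (|p|·R²) · Σ_k ‖Y i₀ k‖²` for every row `i₀`
(`1 = (Y Y′)_{i₀i₀} = Σ_k Y_{i₀k} Y′_{k i₀}`, Cauchy–Schwarz). [cite: BorelJacquet1979, §4.1] -/
theorem one_le_card_mul_sq_mul_rowSq [DecidableEq p] {Y Y' : Matrix p p ℂ} (h : Y * Y' = 1) {R : ℝ} (hR' : ∀ i j, ‖Y' i j‖ ≤ R) (i₀ : p) :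
    1 ≤ (Fintype.card p * R ^ 2) * ∑ k, ‖Y i₀ k‖ ^ 2 := by
  have hR0 : 0 ≤ R := (norm_nonneg _).trans (hR' i₀ i₀)
  have h1 : (1 : ℂ) = ∑ k, Y i₀ k * Y' k i₀ := by rw [← Matrix.mul_apply, h, Matrix.one_apply_eq]
  have h2 : (1 : ℝ) ≤ R * ∑ k, ‖Y i₀ k‖ := by
    calc (1 : ℝ) = ‖∑ k, Y i₀ k * Y' k i₀‖ := by rw [← h1, norm_one]
      _ ≤ ∑ k, ‖Y i₀ k * Y' k i₀‖ := norm_sum_le _ _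
      _ ≤ ∑ k, ‖Y i₀ k‖ * R := Finset.sum_le_sum fun k _ => by
          rw [norm_mul]; exact mul_le_mul_of_nonneg_left (hR' k i₀) (norm_nonneg _)
      _ = R * ∑ k, ‖Y i₀ k‖ := by rw [← Finset.sum_mul, mul_comm]
  have hS0 : 0 ≤ ∑ k, ‖Y i₀ k‖ := Finset.sum_nonneg fun k _ => norm_nonneg _
  have h3 : (1 : ℝ) ≤ R ^ 2 * (∑ k, ‖Y i₀ k‖) ^ 2 := by
    have := pow_le_pow_left₀ zero_le_one h2 2
    rw [one_pow, mul_pow] at this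
    exact this
  have h4 := sq_sum_le_card_mul_sum_sq fun k => ‖Y i₀ k‖
  calc (1 : ℝ) ≤ R ^ 2 * (∑ k, ‖Y i₀ k‖) ^ 2 := h3
    _ ≤ R ^ 2 * (Fintype.card p * ∑ k, ‖Y i₀ k‖ ^ 2) := mul_le_mul_of_nonneg_left h4 (sq_nonneg R)
    _ = (Fintype.card p * R ^ 2) * ∑ k, ‖Y i₀ k‖ ^ 2 := by ring

/-- **CEILING OF THE CORNER ROW**: entries of `Y` bounded by `R` ⇒ `Σ_k ‖Y i₀ k‖² ≤ |p| · R²`. [folklore] -/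
theorem rowSq_le_card_mul_sq {Y : Matrix p p ℂ} {R : ℝ} (hR : ∀ i j, ‖Y i j‖ ≤ R) (i₀ : p) : ∑ k, ‖Y i₀ k‖ ^ 2 ≤ Fintype.card p * R ^ 2 := by
  calc ∑ k, ‖Y i₀ k‖ ^ 2 ≤ ∑ _k : p, R ^ 2 := Finset.sum_le_sum fun k _ => pow_le_pow_left₀ (norm_nonneg _) (hR i₀ k) 2
    _ = Fintype.card p * R ^ 2 := by rw [Finset.sum_const, Finset.card_univ, nsmul_eq_mul]

/-- the corner row of an invertible block is non-zero: `0 < Σ_k ‖Y i₀ k‖²`. [folklore] -/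
theorem rowSq_pos [DecidableEq p] {Y Y' : Matrix p p ℂ} (h : Y * Y' = 1) {R : ℝ} (hR' : ∀ i j, ‖Y' i j‖ ≤ R) (i₀ : p) : 0 < ∑ k, ‖Y i₀ k‖ ^ 2 := by
  have h1 := one_le_card_mul_sq_mul_rowSq h hR' i₀
  have hS0 : 0 ≤ ∑ k, ‖Y i₀ k‖ ^ 2 := Finset.sum_nonneg fun k _ => sq_nonneg _
  rcases hS0.lt_or_eq with hpos | h0
  · exact hpos
  · rw [← h0, mul_zero] at h1; exact absurd h1 (by norm_num)

/-- **POWERS OF THE CORNER ROW, EITHER SIGN**: `Y·Y′ = 1`, entries of `Y, Y′` bounded by `R` ⇒ `(Σ_k ‖Y i₀ k‖²)^t ≤ (|p|·R²)^{|t|}` for every real `t`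
(★ (dec-3b-ii) §1 `rpow_le_rpow_abs` on the two-sided bound). [cite: BorelJacquet1979, §1.2, §4.1] -/
theorem rowSq_rpow_le [DecidableEq p] {Y Y' : Matrix p p ℂ} (h : Y * Y' = 1) {R : ℝ} (hR : ∀ i j, ‖Y i j‖ ≤ R) (hR' : ∀ i j, ‖Y' i j‖ ≤ R) (i₀ : p) (t : ℝ) :
    (∑ k, ‖Y i₀ k‖ ^ 2) ^ t ≤ (Fintype.card p * R ^ 2) ^ |t| := by
  have hpos := rowSq_pos h hR' i₀
  have hup := rowSq_le_card_mul_sq hR i₀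
  have hlo : (∑ k, ‖Y i₀ k‖ ^ 2)⁻¹ ≤ Fintype.card p * R ^ 2 := by
    rw [inv_eq_one_div, div_le_iff₀ hpos]
    exact one_le_card_mul_sq_mul_rowSq h hR' i₀
  exact rpow_le_rpow_abs hpos hup hlo t

/-- **POWERS OF THE DETERMINANT, EITHER SIGN**: `Y·Y′ = 1`, entries of `Y, Y′` bounded by `R` ⇒ `‖det Y‖^t ≤ (|p|!·R^{|p|})^{|t|}` for every real `t`
(`‖det Y‖, ‖det Y‖⁻¹ = ‖det Y′‖ ≤ |p|!·R^{|p|}`, ★ G7-B `norm_det_le_of_entry_le`). [cite: BorelJacquet1979, §1.2, §4.1] -/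
theorem norm_det_rpow_le [DecidableEq p] {Y Y' : Matrix p p ℂ} (h : Y * Y' = 1) {R : ℝ} (hR : ∀ i j, ‖Y i j‖ ≤ R) (hR' : ∀ i j, ‖Y' i j‖ ≤ R) (t : ℝ) :
    ‖Y.det‖ ^ t ≤ (((Fintype.card p).factorial : ℝ) * R ^ Fintype.card p) ^ |t| := by
  have hdet1 : Y.det * Y'.det = 1 := by rw [← Matrix.det_mul, h, Matrix.det_one]
  have hz0 : 0 < ‖Y.det‖ := norm_pos_iff.2 fun h0 => by simp [h0] at hdet1
  have hup : ‖Y.det‖ ≤ ((Fintype.card p).factorial : ℝ) * R ^ Fintype.card p := norm_det_le_of_entry_le hR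
  have hlo : ‖Y.det‖⁻¹ ≤ ((Fintype.card p).factorial : ℝ) * R ^ Fintype.card p := by
    have hinv : ‖Y.det‖⁻¹ = ‖Y'.det‖ := by
      rw [← norm_inv]; congr 1; exact inv_eq_of_mul_eq_one_right hdet1
    rw [hinv]; exact norm_det_le_of_entry_le hR'
  exact rpow_le_rpow_abs hz0 hup hlo t

end CornerRow

/-! ## §3 The faces against the height of the point, for every block decomposition (★ G7 frame currency) -/

section HeightFaces

open scoped ComplexOrder
open NumberField NumberField.mixedEmbedding NumberField.InfinitePlace IsDedekindDomain
open Literature.NumberTheory.Automorphic Literature.NumberTheory.Automorphic.UnitaryGroup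

variable (F E : Type) [Field F] [NumberField F] [Field E] [NumberField E] [Algebra F E] (c : E ≃ₐ[F] E) (N : ℕ) (J : Matrix (Fin N) (Fin N) E)
variable {S p : Type*} [Fintype S] [Fintype p] [DecidableEq p]

omit [Fintype S] in
/-- the per-place block data of a point from ★ G7-B `block_entry_bounds`: entries of `Y σ`, `(Y σ)⁻¹` below `c_B·‖x‖` and `Y σ · (Y σ)⁻¹ = 1`. [cite: BorelJacquet1979, §4.1] -/
theorem blockData_of_decomp [NeZero N] (hc : c ≠ 1) (w : S → {w : InfinitePlace E // IsComplex w}) (hw : ∀ σ, c • (w σ).1 = (w σ).1)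
    (r : p ⊕ p ≃ Fin N) (T Tinv : S → Matrix (p ⊕ p) (p ⊕ p) ℂ) (hT : ∀ σ, T σ * Tinv σ = 1) (hT' : ∀ σ, Tinv σ * T σ = 1)
    {M : ℝ} (hM : 1 ≤ M) (hTe : ∀ σ i j, ‖T σ i j‖ ≤ M) (hTe' : ∀ σ i j, ‖Tinv σ i j‖ ≤ M)
    (x : (adelicGroupData F E c N J).Adelic) (Y b d : S → Matrix p p ℂ) (κ κ' : S → Matrix (p ⊕ p) (p ⊕ p) ℂ)
    (hκ : ∀ σ, κ σ * κ' σ = 1) (hκ' : ∀ σ, κ' σ * κ σ = 1) (hκe : ∀ σ i j, ‖κ σ i j‖ ≤ M) (hκe' : ∀ σ i j, ‖κ' σ i j‖ ≤ M)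
    (hdec : ∀ σ, T σ * Matrix.reindex r.symm r.symm
        ((((archAt F E c N J (w σ) (hw σ) hc (archPart F E c N J x) : archLocal E N J (w σ)) : GL (Fin N) ℂ) : Matrix (Fin N) (Fin N) ℂ)) *
        Tinv σ = Matrix.fromBlocks (Y σ) (b σ) 0 (d σ) * κ σ) (σ : S) :
    (∀ i j, ‖Y σ i j‖ ≤ (Fintype.card (p ⊕ p) : ℝ) ^ 3 * M ^ 3 * adelicHeightGL N E (adelicVal F E c N J x)) ∧
      (∀ i j, ‖(Y σ)⁻¹ i j‖ ≤ (Fintype.card (p ⊕ p) : ℝ) ^ 3 * M ^ 3 * adelicHeightGL N E (adelicVal F E c N J x)) ∧ Y σ * (Y σ)⁻¹ = 1 := by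
  have hg := norm_archAt_archPart_apply_le F E c N J (w σ) (hw σ) hc x
  have hmul : ((((archAt F E c N J (w σ) (hw σ) hc (archPart F E c N J x) : archLocal E N J (w σ)) : GL (Fin N) ℂ) : Matrix (Fin N) (Fin N) ℂ)) *
      ((((archAt F E c N J (w σ) (hw σ) hc (archPart F E c N J x))⁻¹ : archLocal E N J (w σ)) : GL (Fin N) ℂ) : Matrix (Fin N) (Fin N) ℂ) = 1 := by
    rw [Subgroup.coe_inv, Matrix.coe_units_inv, Matrix.mul_nonsing_inv _ (Matrix.isUnits_det_units _)]
  exact block_entry_bounds r (hT σ) (hT' σ) (hκ σ) (hκ' σ) (zero_le_one.trans hM) (hTe σ) (hTe' σ) (hκe σ) (hκe' σ) hmul (adelicHeightGL_nonneg _)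
    (fun i j => (hg i j).1) (fun i j => (hg i j).2) (hdec σ)

/-- **FACE 1 — POWERS OF THE CORNER ROW AGAINST THE HEIGHT, EITHER SIGN.**  Frame data BY VALUE (★ G7), a row `i₀ : p` and an exponent bound `t₀ ≥ 0`: `∃ C A′ ≥ 0`
(`C = (|p|·c_B²)^{t₀#S}`, `A′ = 2t₀#S`) such that for every point `x`, all movers, EVERY block decomposition and every real `t` with `|t| ≤ t₀`:
`∏_σ (Σ_k ‖Y σ i₀ k‖²)^t ≤ C · ‖x‖^{A′}`. [cite: BorelJacquet1979, §1.2, §4.1] [cite: MoeglinWaldspurger1995, I.2.2, II.1.7] -/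
theorem prod_rowSq_rpow_le_height [NeZero N] (hc : c ≠ 1) (w : S → {w : InfinitePlace E // IsComplex w}) (hw : ∀ σ, c • (w σ).1 = (w σ).1)
    (r : p ⊕ p ≃ Fin N) (T Tinv : S → Matrix (p ⊕ p) (p ⊕ p) ℂ) (hT : ∀ σ, T σ * Tinv σ = 1) (hT' : ∀ σ, Tinv σ * T σ = 1)
    {M : ℝ} (hM : 1 ≤ M) (hTe : ∀ σ i j, ‖T σ i j‖ ≤ M) (hTe' : ∀ σ i j, ‖Tinv σ i j‖ ≤ M) (i₀ : p) {t₀ : ℝ} (ht₀ : 0 ≤ t₀) :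
    ∃ C A' : ℝ, 0 ≤ C ∧ 0 ≤ A' ∧ ∀ (x : (adelicGroupData F E c N J).Adelic) (Y b d : S → Matrix p p ℂ) (κ κ' : S → Matrix (p ⊕ p) (p ⊕ p) ℂ),
      (∀ σ, κ σ * κ' σ = 1) → (∀ σ, κ' σ * κ σ = 1) → (∀ σ i j, ‖κ σ i j‖ ≤ M) → (∀ σ i j, ‖κ' σ i j‖ ≤ M) →
      (∀ σ, T σ * Matrix.reindex r.symm r.symm
          ((((archAt F E c N J (w σ) (hw σ) hc (archPart F E c N J x) : archLocal E N J (w σ)) : GL (Fin N) ℂ) : Matrix (Fin N) (Fin N) ℂ)) *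
          Tinv σ = Matrix.fromBlocks (Y σ) (b σ) 0 (d σ) * κ σ) →
      ∀ t : ℝ, |t| ≤ t₀ → ∏ σ, (∑ k, ‖Y σ i₀ k‖ ^ 2) ^ t ≤ C * adelicHeightGL N E (adelicVal F E c N J x) ^ A' := by
  obtain ⟨c₀, hc₀, hfloor⟩ := exists_adelicHeightGL_floor E N
  set cB : ℝ := (Fintype.card (p ⊕ p) : ℝ) ^ 3 * M ^ 3 with hcB
  have hcB0 : 0 ≤ cB := by positivity
  set K : ℝ := Fintype.card p * cB ^ 2 with hK
  have hK0 : 0 ≤ K := by positivity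
  refine ⟨K ^ (t₀ * Fintype.card S), 2 * t₀ * Fintype.card S, Real.rpow_nonneg hK0 _, by positivity,
    fun x Y b d κ κ' hκ hκ' hκe hκe' hdec t ht => ?_⟩
  set H : ℝ := adelicHeightGL N E (adelicVal F E c N J x) with hH
  have hH0 : 0 < H := lt_of_lt_of_le hc₀ (hfloor _)
  have hblk := blockData_of_decomp F E c N J hc w hw r T Tinv hT hT' hM hTe hTe' x Y b d κ κ' hκ hκ' hκe hκe' hdec
  -- per place: `ρ_σ^t ≤ (K H²)^{t₀}`, `K H² = |p| (cB H)² ≥ 1`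
  have hfac : ∀ σ, (∑ k, ‖Y σ i₀ k‖ ^ 2) ^ t ≤ (K * H ^ 2) ^ t₀ := fun σ => by
    obtain ⟨hy, hyi, hyy⟩ := hblk σ
    have hpos := rowSq_pos hyy hyi i₀
    have hup : ∑ k, ‖Y σ i₀ k‖ ^ 2 ≤ K * H ^ 2 := (rowSq_le_card_mul_sq hy i₀).trans (le_of_eq (by rw [hK]; ring))
    have hlo : (∑ k, ‖Y σ i₀ k‖ ^ 2)⁻¹ ≤ K * H ^ 2 := by
      rw [inv_eq_one_div, div_le_iff₀ hpos]
      calc (1 : ℝ) ≤ (Fintype.card p * (cB * H) ^ 2) * ∑ k, ‖Y σ i₀ k‖ ^ 2 := one_le_card_mul_sq_mul_rowSq hyy hyi i₀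
        _ = K * H ^ 2 * ∑ k, ‖Y σ i₀ k‖ ^ 2 := by rw [hK]; ring
    exact rpow_le_rpow_of_abs_le hpos hup hlo ht
  have hfac0 : ∀ σ, 0 ≤ (∑ k, ‖Y σ i₀ k‖ ^ 2) ^ t := fun σ => Real.rpow_nonneg (Finset.sum_nonneg fun k _ => sq_nonneg _) _
  have hKH0 : 0 ≤ K * H ^ 2 := by positivity
  calc ∏ σ, (∑ k, ‖Y σ i₀ k‖ ^ 2) ^ t ≤ ∏ _σ : S, (K * H ^ 2) ^ t₀ := Finset.prod_le_prod (fun σ _ => hfac0 σ) fun σ _ => hfac σ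
    _ = ((K * H ^ 2) ^ t₀) ^ Fintype.card S := by rw [Finset.prod_const, Finset.card_univ]
    _ = K ^ (t₀ * Fintype.card S) * H ^ (2 * t₀ * Fintype.card S) := by
        rw [← Real.rpow_natCast, ← Real.rpow_mul hKH0, Real.mul_rpow hK0 (pow_nonneg hH0.le 2), ← Real.rpow_natCast H 2,
          ← Real.rpow_mul hH0.le]
        congr 2
        push_cast
        ring

/-- **FACE 2 — POWERS OF THE CORNER DETERMINANT AGAINST THE HEIGHT, EITHER SIGN.**  Same frame data, `t₀ ≥ 0`: `∃ C A′ ≥ 0` (`C = (|p|!·c_B^{|p|})^{t₀#S}`, `A′ = |p|t₀#S`)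
with `∏_σ ‖det Y σ‖^t ≤ C · ‖x‖^{A′}` for every point, all movers, every block decomposition and `|t| ≤ t₀` (the off-corner Levi factor `‖r‖ = ‖det Y‖ ∕ ρ^{1∕2}` is FACE 2 ∕ FACE 1).
[cite: BorelJacquet1979, §1.2, §4.1] [cite: MoeglinWaldspurger1995, I.2.2, II.1.7] -/
theorem prod_norm_det_rpow_le_height [NeZero N] (hc : c ≠ 1) (w : S → {w : InfinitePlace E // IsComplex w}) (hw : ∀ σ, c • (w σ).1 = (w σ).1)
    (r : p ⊕ p ≃ Fin N) (T Tinv : S → Matrix (p ⊕ p) (p ⊕ p) ℂ) (hT : ∀ σ, T σ * Tinv σ = 1) (hT' : ∀ σ, Tinv σ * T σ = 1)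
    {M : ℝ} (hM : 1 ≤ M) (hTe : ∀ σ i j, ‖T σ i j‖ ≤ M) (hTe' : ∀ σ i j, ‖Tinv σ i j‖ ≤ M) {t₀ : ℝ} (ht₀ : 0 ≤ t₀) :
    ∃ C A' : ℝ, 0 ≤ C ∧ 0 ≤ A' ∧ ∀ (x : (adelicGroupData F E c N J).Adelic) (Y b d : S → Matrix p p ℂ) (κ κ' : S → Matrix (p ⊕ p) (p ⊕ p) ℂ),
      (∀ σ, κ σ * κ' σ = 1) → (∀ σ, κ' σ * κ σ = 1) → (∀ σ i j, ‖κ σ i j‖ ≤ M) → (∀ σ i j, ‖κ' σ i j‖ ≤ M) →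
      (∀ σ, T σ * Matrix.reindex r.symm r.symm
          ((((archAt F E c N J (w σ) (hw σ) hc (archPart F E c N J x) : archLocal E N J (w σ)) : GL (Fin N) ℂ) : Matrix (Fin N) (Fin N) ℂ)) *
          Tinv σ = Matrix.fromBlocks (Y σ) (b σ) 0 (d σ) * κ σ) →
      ∀ t : ℝ, |t| ≤ t₀ → ∏ σ, ‖(Y σ).det‖ ^ t ≤ C * adelicHeightGL N E (adelicVal F E c N J x) ^ A' := by
  obtain ⟨c₀, hc₀, hfloor⟩ := exists_adelicHeightGL_floor E N
  set cB : ℝ := (Fintype.card (p ⊕ p) : ℝ) ^ 3 * M ^ 3 with hcB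
  have hcB0 : 0 ≤ cB := by positivity
  set m : ℕ := Fintype.card p with hm
  set K : ℝ := (m.factorial : ℝ) * cB ^ m with hK
  have hK0 : 0 ≤ K := by positivity
  refine ⟨K ^ (t₀ * Fintype.card S), m * t₀ * Fintype.card S, Real.rpow_nonneg hK0 _, by positivity,
    fun x Y b d κ κ' hκ hκ' hκe hκe' hdec t ht => ?_⟩
  set H : ℝ := adelicHeightGL N E (adelicVal F E c N J x) with hH
  have hH0 : 0 < H := lt_of_lt_of_le hc₀ (hfloor _)
  have hblk := blockData_of_decomp F E c N J hc w hw r T Tinv hT hT' hM hTe hTe' x Y b d κ κ' hκ hκ' hκe hκe' hdec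
  -- per place: `‖det Y σ‖^t ≤ (m!·(cB H)^m)^{|t|} ≤ (K H^m)^{t₀}`
  have hfac : ∀ σ, ‖(Y σ).det‖ ^ t ≤ (K * H ^ m) ^ t₀ := fun σ => by
    obtain ⟨hy, hyi, hyy⟩ := hblk σ
    have hdet1 : (Y σ).det * ((Y σ)⁻¹).det = 1 := by rw [← Matrix.det_mul, hyy, Matrix.det_one]
    have hz0 : 0 < ‖(Y σ).det‖ := norm_pos_iff.2 fun h0 => by simp [h0] at hdet1
    have hup : ‖(Y σ).det‖ ≤ K * H ^ m := (norm_det_le_of_entry_le hy).trans (le_of_eq (by rw [hK, hm, mul_pow]; ring))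
    have hlo : ‖(Y σ).det‖⁻¹ ≤ K * H ^ m := by
      have hinv : ‖(Y σ).det‖⁻¹ = ‖((Y σ)⁻¹).det‖ := by
        rw [← norm_inv]; congr 1; exact inv_eq_of_mul_eq_one_right hdet1
      rw [hinv]
      exact (norm_det_le_of_entry_le hyi).trans (le_of_eq (by rw [hK, hm, mul_pow]; ring))
    exact rpow_le_rpow_of_abs_le hz0 hup hlo ht
  have hfac0 : ∀ σ, 0 ≤ ‖(Y σ).det‖ ^ t := fun σ => Real.rpow_nonneg (norm_nonneg _) _
  have hKH0 : 0 ≤ K * H ^ m := by positivity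
  calc ∏ σ, ‖(Y σ).det‖ ^ t ≤ ∏ _σ : S, (K * H ^ m) ^ t₀ := Finset.prod_le_prod (fun σ _ => hfac0 σ) fun σ _ => hfac σ
    _ = ((K * H ^ m) ^ t₀) ^ Fintype.card S := by rw [Finset.prod_const, Finset.card_univ]
    _ = K ^ (t₀ * Fintype.card S) * H ^ ((m : ℝ) * t₀ * Fintype.card S) := by
        rw [← Real.rpow_natCast, ← Real.rpow_mul hKH0, Real.mul_rpow hK0 (pow_nonneg hH0.le m), ← Real.rpow_natCast H m,
          ← Real.rpow_mul hH0.le]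
        congr 2
        ring

/-- **FACE 3 — THE POLYNOMIAL FACE OF THE CORNER ROW.**  Same frame data: `∃ C₂ > 0` (`C₂ = (c₀⁻² + |p|c_B²)^{#S}`) with, for every point, all movers, every block
decomposition, all `m σ ≥ 0` (read `|μ|_σ`) and every `k : ℕ`:  `∏_σ (1 + m σ · Σ_j ‖Y σ i₀ j‖²)^k ≤ C₂^k · ‖x‖^{2#S k} · (1 + Σ_σ m σ)^{#S k}`
(★ (KW1-d) §2 `prod_one_add_mul_normSq_pow_le_height` is the `p := Fin 1` case). [cite: MoeglinWaldspurger1995, I.2.2, II.1.5] [cite: BorelJacquet1979, §1.2, §4.1] -/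
theorem prod_one_add_mul_rowSq_pow_le_height [NeZero N] (hc : c ≠ 1) (w : S → {w : InfinitePlace E // IsComplex w}) (hw : ∀ σ, c • (w σ).1 = (w σ).1)
    (r : p ⊕ p ≃ Fin N) (T Tinv : S → Matrix (p ⊕ p) (p ⊕ p) ℂ) (hT : ∀ σ, T σ * Tinv σ = 1) (hT' : ∀ σ, Tinv σ * T σ = 1)
    {M : ℝ} (hM : 1 ≤ M) (hTe : ∀ σ i j, ‖T σ i j‖ ≤ M) (hTe' : ∀ σ i j, ‖Tinv σ i j‖ ≤ M) (i₀ : p) :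
    ∃ C₂ : ℝ, 0 < C₂ ∧ ∀ (x : (adelicGroupData F E c N J).Adelic) (Y b d : S → Matrix p p ℂ) (κ κ' : S → Matrix (p ⊕ p) (p ⊕ p) ℂ),
      (∀ σ, κ σ * κ' σ = 1) → (∀ σ, κ' σ * κ σ = 1) → (∀ σ i j, ‖κ σ i j‖ ≤ M) → (∀ σ i j, ‖κ' σ i j‖ ≤ M) →
      (∀ σ, T σ * Matrix.reindex r.symm r.symm
          ((((archAt F E c N J (w σ) (hw σ) hc (archPart F E c N J x) : archLocal E N J (w σ)) : GL (Fin N) ℂ) : Matrix (Fin N) (Fin N) ℂ)) *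
          Tinv σ = Matrix.fromBlocks (Y σ) (b σ) 0 (d σ) * κ σ) →
      ∀ m : S → ℝ, (∀ σ, 0 ≤ m σ) → ∀ k : ℕ,
        ∏ σ, (1 + m σ * ∑ j, ‖Y σ i₀ j‖ ^ 2) ^ k ≤
          C₂ ^ k * adelicHeightGL N E (adelicVal F E c N J x) ^ (((2 * Fintype.card S * k : ℕ)) : ℝ) * (1 + ∑ σ, m σ) ^ (Fintype.card S * k) := by
  obtain ⟨c₀, hc₀, hfloor⟩ := exists_adelicHeightGL_floor E N
  set cB : ℝ := (Fintype.card (p ⊕ p) : ℝ) ^ 3 * M ^ 3 with hcB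
  have hcB0 : 0 ≤ cB := by positivity
  set K : ℝ := (c₀ ^ 2)⁻¹ + Fintype.card p * cB ^ 2 with hK
  have hK0 : 0 < K := by positivity
  refine ⟨K ^ Fintype.card S, pow_pos hK0 _, fun x Y b d κ κ' hκ hκ' hκe hκe' hdec m hm k => ?_⟩
  set H : ℝ := adelicHeightGL N E (adelicVal F E c N J x) with hH
  have hHc : c₀ ≤ H := hfloor _
  have hH0 : 0 < H := lt_of_lt_of_le hc₀ hHc
  have hblk := blockData_of_decomp F E c N J hc w hw r T Tinv hT hT' hM hTe hTe' x Y b d κ κ' hκ hκ' hκe hκe' hdec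
  have hsum0 : 0 ≤ ∑ σ, m σ := Finset.sum_nonneg fun σ _ => hm σ
  -- per place: `ρ_σ ≤ |p| cB² H²` and `1 + m ρ ≤ K H² (1 + Σ m)`
  have hρ : ∀ σ, ∑ j, ‖Y σ i₀ j‖ ^ 2 ≤ Fintype.card p * cB ^ 2 * H ^ 2 := fun σ =>
    (rowSq_le_card_mul_sq (hblk σ).1 i₀).trans (le_of_eq (by ring))
  have hKH : 1 + Fintype.card p * cB ^ 2 * H ^ 2 ≤ K * H ^ 2 := by
    have h1 : 1 ≤ (c₀ ^ 2)⁻¹ * H ^ 2 := by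
      rw [inv_mul_eq_div, le_div_iff₀ (by positivity)]
      nlinarith [mul_nonneg hc₀.le hH0.le]
    rw [hK]; nlinarith
  have hplace : ∀ σ, 1 + m σ * ∑ j, ‖Y σ i₀ j‖ ^ 2 ≤ K * H ^ 2 * (1 + ∑ σ', m σ') := fun σ => by
    have h1 : m σ * ∑ j, ‖Y σ i₀ j‖ ^ 2 ≤ m σ * (Fintype.card p * cB ^ 2 * H ^ 2) := mul_le_mul_of_nonneg_left (hρ σ) (hm σ)
    have hmσ : m σ ≤ ∑ σ', m σ' := Finset.single_le_sum (fun σ' _ => hm σ') (Finset.mem_univ σ)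
    have hP0 : 0 ≤ Fintype.card p * cB ^ 2 * H ^ 2 := by positivity
    have h2 : 1 + m σ * (Fintype.card p * cB ^ 2 * H ^ 2) ≤ (1 + Fintype.card p * cB ^ 2 * H ^ 2) * (1 + m σ) := by nlinarith [hm σ]
    calc 1 + m σ * ∑ j, ‖Y σ i₀ j‖ ^ 2 ≤ 1 + m σ * (Fintype.card p * cB ^ 2 * H ^ 2) := by linarith
      _ ≤ (1 + Fintype.card p * cB ^ 2 * H ^ 2) * (1 + m σ) := h2
      _ ≤ K * H ^ 2 * (1 + ∑ σ', m σ') := mul_le_mul hKH (by linarith) (by linarith [hm σ]) (mul_nonneg hK0.le (sq_nonneg _))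
  have hplace0 : ∀ σ, 0 ≤ 1 + m σ * ∑ j, ‖Y σ i₀ j‖ ^ 2 := fun σ =>
    add_nonneg zero_le_one (mul_nonneg (hm σ) (Finset.sum_nonneg fun j _ => sq_nonneg _))
  have hprod : ∏ σ, (1 + m σ * ∑ j, ‖Y σ i₀ j‖ ^ 2) ≤ (K * H ^ 2 * (1 + ∑ σ', m σ')) ^ Fintype.card S := by
    calc ∏ σ, (1 + m σ * ∑ j, ‖Y σ i₀ j‖ ^ 2) ≤ ∏ _σ : S, K * H ^ 2 * (1 + ∑ σ', m σ') :=
          Finset.prod_le_prod (fun σ _ => hplace0 σ) fun σ _ => hplace σ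
      _ = (K * H ^ 2 * (1 + ∑ σ', m σ')) ^ Fintype.card S := by rw [Finset.prod_const, Finset.card_univ]
  calc ∏ σ, (1 + m σ * ∑ j, ‖Y σ i₀ j‖ ^ 2) ^ k = (∏ σ, (1 + m σ * ∑ j, ‖Y σ i₀ j‖ ^ 2)) ^ k := Finset.prod_pow _ _ _
    _ ≤ ((K * H ^ 2 * (1 + ∑ σ', m σ')) ^ Fintype.card S) ^ k :=
        pow_le_pow_left₀ (Finset.prod_nonneg fun σ _ => hplace0 σ) hprod k
    _ = (K ^ Fintype.card S) ^ k * H ^ (((2 * Fintype.card S * k : ℕ)) : ℝ) * (1 + ∑ σ, m σ) ^ (Fintype.card S * k) := by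
        have e1 : ((K * H ^ 2 * (1 + ∑ σ', m σ')) ^ Fintype.card S) ^ k =
            K ^ (Fintype.card S * k) * (H ^ 2) ^ (Fintype.card S * k) * (1 + ∑ σ', m σ') ^ (Fintype.card S * k) := by
          rw [← pow_mul, mul_pow, mul_pow]
        have e2 : (H ^ 2) ^ (Fintype.card S * k) = H ^ (2 * Fintype.card S * k) := by rw [← pow_mul, mul_assoc]
        rw [Real.rpow_natCast, e1, e2, pow_mul K (Fintype.card S) k]

end HeightFaces

end Summit.HodgeConjecture.HodgeConjecture.Cruxes.HLiu418.K2LiuKindOneLineCornerBlockFaces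

end
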